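import Literature.AlgebraicGeometry.Frobenioids.ArchimedeanFSMProofs
import Literature.AlgebraicGeometry.Frobenioids.ArchimedeanFSMMonoCondBR
import Literature.AlgebraicGeometry.Frobenioids.ArchimedeanFSMPullbackFSMI
import Literature.AlgebraicGeometry.Frobenioids.ArchimedeanFSMLifting
import HarnessLib

/-!
# Frobenioids II, Proposition 3.4 (i), (ii), (iv), (vi), (vii): the instance forms at THE three named
# towers, by name
# (abc-iut cell, block F fact-proving wave, seat f-011 (float on the trunk `ArchimedeanFSM.lean`):
# FACT-LIST rows F-0815 `ArchFrd.Tower.PropI`, F-0816 `ArchFrd.Tower.PropII`, F-0818 `ArchFrd.Tower.PropIV`,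
# F-0820 `ArchFrd.Tower.PropVI`, F-0821 `ArchFrd.Tower.PropVII`)

Mochizuki, *The geometry of Frobenioids II: poly-Frobenioids*, Kyushu J. Math. **62** (2008)
401–460, §3, Proposition 3.4 pp. 29–30 [cite: MochizukiFrdII2008, Prop 3.4 pp.29-30]:

> "In the notation and terminology of Example 3.3, let `F` be one of the following categories: `A`, `N`,
> `R`. … (i) Fiberwise-surjective morphisms of `F` project to fiberwise-surjective morphisms of `D`.
> (ii) Suppose that `φ` is a monomorphism of `F` that satisfies at least one of the following two
> conditions: (a) … (b) … Then `φ` projects to a monomorphism `φ_D` of `D`. … (iv) Suppose that `D` is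
> complexifiable. Then any FSM-morphism (respectively, FSMI-morphism) of `F` that projects to an
> isomorphism of `D` projects to an FSM-morphism (respectively, FSMI-morphism) of `F₀`. … (vi) If `φ` is
> a morphism of `F` such that `φ_D` admits a factorization `φ_D = α_D ∘ β_D` in `D`, then there exist
> morphisms `α`, `β` of `F` lifting `α_D`, `β_D`, respectively, such that `φ = α ∘ β` in `F`. … (vii) Let
> `φ` be a morphism of `F` that projects to a pull-back morphism of `F₀` and to an FSM-morphism
> (respectively, FSMI-morphism) of `D`. Then `φ` is an FSM-morphism (respectively, FSMI-morphism) of `F`."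

PROOF-ONLY companion of `ArchimedeanFSM.lean` (statements, seat abc-iut-L1-t6; DEFS-FROZEN — imported,
never edited); nothing is defined here, no statement of the paper is retyped or strengthened, and NO NEW
MATHEMATICS is proved: every theorem below is a landed theorem of the cell BY NAME.

WHY THIS FILE EXISTS. The five rows are PARAMETRISED schemata — predicates `Tower.PropI`, … of an
ABSTRACT tower `T : ArchFrd.Tower π` (seat abc-iut-L1-t6 states each printed item once for a tower and
defines the printed item as the conjunction over the three named towers `towerA π`, `towerN π`,
`towerR π`). Their universal closures over a free tower binder are FALSE (junk towers over finite
posets: `ArchFrd.Tower.not_forall_propI`, `…_propII`, `…_propIV`, `…_propVI`, `…_propVII`, seat f-010,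
`ArchimedeanFSMTowerSchemaProjections.lean`), while the INSTANCE FORMS at the three named towers — what
print asserts — are PROVED over EVERY base `π : D ⥤ D₀`, hypothesis-free, by the landed theorems
`ArchFrd.prop34_i_holds` (abc-iut-L1-d3, `ArchimedeanFSMProofs.lean`), `ArchFrd.prop34_ii_holds`
(`ArchimedeanFSMMonoCondBR.lean`), `ArchFrd.prop34_iv_holds` (`ArchimedeanFSMOverIsoProofs.lean`),
`ArchFrd.prop34_vi_main` (`ArchimedeanFSMLifting.lean`), `ArchFrd.prop34_vii_holds`
(`ArchimedeanFSMPullbackFSMI.lean`). The cell indexes kernel witnesses of FACT-LIST rows by the name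
`<lowerCamel decl>_holds` (plan/F-TRANCHES.tsv header; R5: for a schema row, the instance forms the
consumers cite); this file supplies exactly those names with fully-qualified types (precedent:
`prop32i_holds`, `thm64i_frobenioid_holds`; sibling `ArchimedeanFSMTowerHolds.lean` for rows F-0823/F-0824).
NOT covered, deliberately: row F-0817 `Tower.PropIII` — its instance forms at the named towers are
themselves base-dependent (REFUTED over the genuine base `D := D₀`, `π := 𝟭`, `Tower.propIII_named_id_false`;
proved in the complex regime, `A.propIII_of_isComplexRegime` …; the repaired printed item `Prop34_iiiR` is
proved, `prop34_iiiR_holds`), so no `propIII_holds` can be written.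

A FACT row is an assumption label, not an endorsement; refuted-as-schema ≠ refuted-in-print; typed ≠
proved for anything not cited here; no side is taken on [IUTchIII] Cor. 3.12.
-/

namespace Literature.AlgebraicGeometry.Frobenioids

open CategoryTheory

noncomputable section

namespace ArchFrd

universe v u

variable {D : Type u} [Category.{v} D] (π : D ⥤ D0)

/-- **FACT-LIST row F-0815 `ArchFrd.Tower.PropI` HOLDS at THE printed instances**: for `F = A, N, R`
over EVERY base `π : D ⥤ D₀`, "fiberwise-surjective morphisms of `F` project to fiberwise-surjective
morphisms of `D`" ([FrdII] Prop. 3.4 (i), kurims p. 29) — abc-iut-L1-d3's `ArchFrd.prop34_i_holds` BY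
NAME (fully-qualified type; R5: instance form, the universal closure over an abstract tower being false,
`ArchFrd.Tower.not_forall_propI`). No hypothesis. [cite: MochizukiFrdII2008, Prop 3.4 (i) p.29] -/
theorem Tower.propI_holds :
    Literature.AlgebraicGeometry.Frobenioids.ArchFrd.Tower.PropI (towerA π) ∧
      Literature.AlgebraicGeometry.Frobenioids.ArchFrd.Tower.PropI (towerN π) ∧
        Literature.AlgebraicGeometry.Frobenioids.ArchFrd.Tower.PropI (towerR π) :=
  prop34_i_holds π

/-- **FACT-LIST row F-0816 `ArchFrd.Tower.PropII` HOLDS at THE printed instances**: for `F = A, N, R`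
over EVERY base `π : D ⥤ D₀`, a monomorphism of `F` satisfying condition (a) or (b) "projects to a
monomorphism `φ_D` of `D`" ([FrdII] Prop. 3.4 (ii), kurims p. 30) — `ArchFrd.prop34_ii_holds`
(abc-iut-L1-d3, sub-rows P34-L02/L03) BY NAME (fully-qualified type; R5: instance form, the universal
closure over an abstract tower being false, `ArchFrd.Tower.not_forall_propII`). No hypothesis.
[cite: MochizukiFrdII2008, Prop 3.4 (ii) p.30] -/
theorem Tower.propII_holds :
    Literature.AlgebraicGeometry.Frobenioids.ArchFrd.Tower.PropII (towerA π) ∧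
      Literature.AlgebraicGeometry.Frobenioids.ArchFrd.Tower.PropII (towerN π) ∧
        Literature.AlgebraicGeometry.Frobenioids.ArchFrd.Tower.PropII (towerR π) :=
  prop34_ii_holds π

/-- **FACT-LIST row F-0818 `ArchFrd.Tower.PropIV` HOLDS at THE printed instances**: for `F = A, N, R`
over EVERY base `π : D ⥤ D₀` (the item's own hypothesis "`D` complexifiable" is part of the predicate),
an FSM-morphism (resp. FSMI-morphism) of `F` projecting to an isomorphism of `D` projects to an
FSM-morphism (resp. FSMI-morphism) of `F₀` ([FrdII] Prop. 3.4 (iv), kurims p. 30) —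
`ArchFrd.prop34_iv_holds` (sub-node P34-L05) BY NAME (fully-qualified type; R5: instance form, the
universal closure over an abstract tower being false, `ArchFrd.Tower.not_forall_propIV`).
[cite: MochizukiFrdII2008, Prop 3.4 (iv) p.30] -/
theorem Tower.propIV_holds :
    Literature.AlgebraicGeometry.Frobenioids.ArchFrd.Tower.PropIV (towerA π) ∧
      Literature.AlgebraicGeometry.Frobenioids.ArchFrd.Tower.PropIV (towerN π) ∧
        Literature.AlgebraicGeometry.Frobenioids.ArchFrd.Tower.PropIV (towerR π) :=
  prop34_iv_holds π

/-- **FACT-LIST row F-0820 `ArchFrd.Tower.PropVI` HOLDS at THE printed instances**: for `F = A, N, R`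
over EVERY base `π : D ⥤ D₀`, a factorization `φ_D = α_D ∘ β_D` in `D` of the projection of an arrow
`φ` of `F` lifts to a factorization `φ = α ∘ β` in `F` ([FrdII] Prop. 3.4 (vi), main clause, kurims
p. 30; typed up to an identification of the middle object) — abc-iut-L1-d3's `ArchFrd.prop34_vi_main`
BY NAME (fully-qualified type; R5: instance form, the universal closure over an abstract tower being
false, `ArchFrd.Tower.not_forall_propVI`). No hypothesis. The two "in particular" clauses are rows
F-0824/F-0823 (`Tower.propVI_irreducible_holds`, `Tower.propVI_FSMI_holds`, sibling file).
[cite: MochizukiFrdII2008, Prop 3.4 (vi) p.30] -/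
theorem Tower.propVI_holds :
    Literature.AlgebraicGeometry.Frobenioids.ArchFrd.Tower.PropVI (towerA π) ∧
      Literature.AlgebraicGeometry.Frobenioids.ArchFrd.Tower.PropVI (towerN π) ∧
        Literature.AlgebraicGeometry.Frobenioids.ArchFrd.Tower.PropVI (towerR π) :=
  prop34_vi_main π

/-- **FACT-LIST row F-0821 `ArchFrd.Tower.PropVII` HOLDS at THE printed instances**: for `F = A, N, R`
over EVERY base `π : D ⥤ D₀`, an arrow of `F` projecting to a pull-back morphism of `F₀` and to an
FSM-morphism (resp. FSMI-morphism) of `D` is an FSM-morphism (resp. FSMI-morphism) of `F` ([FrdII]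
Prop. 3.4 (vii), kurims p. 30) — `ArchFrd.prop34_vii_holds` (FSM half abc-iut-L1-d3, FSMI half sub-node
P34-L08) BY NAME (fully-qualified type; R5: instance form, the universal closure over an abstract tower
being false, `ArchFrd.Tower.not_forall_propVII`). No hypothesis. [cite: MochizukiFrdII2008, Prop 3.4 (vii) p.30] -/
theorem Tower.propVII_holds :
    Literature.AlgebraicGeometry.Frobenioids.ArchFrd.Tower.PropVII (towerA π) ∧
      Literature.AlgebraicGeometry.Frobenioids.ArchFrd.Tower.PropVII (towerN π) ∧
        Literature.AlgebraicGeometry.Frobenioids.ArchFrd.Tower.PropVII (towerR π) :=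
  prop34_vii_holds π

end ArchFrd

end

end Literature.AlgebraicGeometry.Frobenioids

-- tree-health (abc-iut-w6-d081 g4, 2026-08-26T12:15Z): comment-only re-land of a STRANDED ACCEPT (module accepted, no olean on hub/farm for > 60 min);
-- declarations byte-identical to the accepted version; purpose = trigger the rebuild (w4-d014 10:34:09Z remedy class). No content change.
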